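import Summits.BirchSwinnertonDyer.BirchSwinnertonDyer.Theorems.Rank2ObservatoryReductionHom
import HarnessLib

/-!
# BirchSwinnertonDyer — rank ≥ 2 observatory: torsion annihilator and point counts in the kernel

HONEST FRAMING: per-curve certified theorems and census instruments; no claim on BSD in rank ≥ 2.

Second of three files discharging `hlow : 2 ≤ rank_ℤ E(ℚ)` by kernel certificate. Contents:

* the TORSION ANNIHILATOR without any injectivity-on-`ℓ`-torsion claim: from kernel point counts
  `N_ℓ = #Ẽ(𝔽_ℓ)` at several good primes (each killing prime-to-`ℓ` orders on `E(ℚ)`,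
  `Rank2ObservatoryReductionHom.card_nsmul_eq_zero_of_nsmul_eq_zero`), the decidable division-free
  Boolean `annihilatorCheck S t` (for every prime `p` some listed `ℓ ≠ p` has the `p`-part of `N_ℓ`
  dividing `t`) gives `t • x = 0` for every `x ∈ E(ℚ)` of finite order
  (`nsmul_eq_zero_of_annihilatorCheck`): the `p`-part of `ord x` is prime to `ℓ ≠ p`, so divides `N_ℓ`;
* `zmodPointCount V q` — the computable count of `V mod q` over `(ZMod q)²` plus one — and
  **`natCard_point_eq_zmodPointCount`**: Mathlib's `Nat.card` of the point type of
  `V.map (ℤ → ZMod q)` IS that count for `q ∤ Δ` (the identification recorded as "not formalised" in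
  `Rank2ObservatoryPointCount.lean`, now a theorem), whence `kills_primeTo_of_zmodPointCount` and
  the list builders `killers_nil` / `killers_cons` for the annihilator's hypothesis.

Sorry-free; axioms `propext`, `Classical.choice`, `Quot.sound` only. References: Silverman AEC (2009)
Prop. VII.3.1(b); J. E. Cremona, *Algorithms for Modular Elliptic Curves* (1997), §2.4, §3.5.
-/

-- single-conjunct summit: `Summit.BirchSwinnertonDyer.BirchSwinnertonDyer.…` repeats the name by design
set_option linter.dupNamespace false

namespace Summit.BirchSwinnertonDyer.BirchSwinnertonDyer.Rank2Observatory

open WeierstrassCurve Literature.NumberTheory.EllipticCurves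

/-! ### Torsion annihilator from reductions at several primes (no injectivity hypothesis) -/

section Annihilator

variable {A : Type*} [AddCommGroup A]

/-- If `(ℓ, N)` kills prime-to-`ℓ` orders on `A` (every `x` with `n • x = 0`, `ℓ ∤ n`, has
`N • x = 0`; for `A = E(ℚ)`, `N = #Ẽ(𝔽_ℓ)` this is `card_nsmul_eq_zero_of_nsmul_eq_zero`) then for
every prime `p ≠ ℓ` the `p`-part of the order of a torsion element divides `N`. [folklore] -/
theorem pow_dvd_of_kills_primeTo {ℓ N : ℕ} (hℓ : ℓ.Prime)
    (hT : ∀ (x : A) (n : ℕ), ¬ ℓ ∣ n → n • x = 0 → N • x = 0) {x : A}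
    (hx : IsOfFinAddOrder x) {p k : ℕ} (hp : p.Prime) (hpl : p ≠ ℓ)
    (hk : p ^ k ∣ addOrderOf x) : p ^ k ∣ N := by
  obtain ⟨e, he⟩ := hk
  have he0 : 0 < e := Nat.pos_of_ne_zero fun h0 => by
    rw [h0, mul_zero] at he
    exact hx.addOrderOf_pos.ne' he
  set y := e • x with hy
  have hpy : (p ^ k) • y = 0 := by
    rw [hy, smul_smul, ← he, addOrderOf_nsmul_eq_zero]
  have hlk : ¬ ℓ ∣ p ^ k := fun h =>
    hpl ((Nat.prime_dvd_prime_iff_eq hℓ hp).mp (hℓ.dvd_of_dvd_pow h)).symm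
  have hNy : N • y = 0 := hT y (p ^ k) hlk hpy
  refine dvd_trans ?_ (addOrderOf_dvd_of_nsmul_eq_zero hNy)
  have hd : addOrderOf x ∣ addOrderOf y * e := by
    apply addOrderOf_dvd_of_nsmul_eq_zero
    rw [← smul_smul, ← hy, addOrderOf_nsmul_eq_zero]
  rw [he] at hd
  exact Nat.dvd_of_mul_dvd_mul_right he0 hd

/-- The bound below which primes are inspected by `annihilatorCheck`: one more than the largest `ℓ`
or `N` occurring in `S`. [folklore] -/
def annBound (S : List (ℕ × ℕ)) : ℕ :=
  S.foldr (fun ℓN b => max (max ℓN.1 ℓN.2) b) 0 + 1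

/-- Every entry of `S` lies below `annBound S` in both coordinates. [folklore] -/
theorem lt_annBound {S : List (ℕ × ℕ)} {ℓN : ℕ × ℕ} (h : ℓN ∈ S) :
    ℓN.1 < annBound S ∧ ℓN.2 < annBound S := by
  unfold annBound
  induction S with
  | nil => simp at h
  | cons a S ih =>
    simp only [List.foldr_cons]
    rcases List.mem_cons.mp h with rfl | h
    · constructor <;> omega
    · have := ih h
      constructor <;> omega

/-- The kernel CERTIFICATE that `t` kills every torsion element, given the reductions `S` (a list
of pairs `(ℓ, N_ℓ)`): `S ≠ []`, every `N > 0`, and for every `p < annBound S` that is not visibly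
composite some `(ℓ, N) ∈ S` with `ℓ ≠ p` has the `p`-part of `N` dividing `t`
(`∀ k ≤ N, p^k ∣ N → p^k ∣ t`). A Boolean: division-free, no primality test, evaluated by `decide`.
[folklore] -/
def annihilatorCheck (S : List (ℕ × ℕ)) (t : ℕ) : Bool :=
  decide (S ≠ [] ∧ (∀ ℓN ∈ S, 0 < ℓN.2) ∧
    ∀ p < annBound S, p < 2 ∨ (∃ m < p, 2 ≤ m ∧ p % m = 0) ∨
      ∃ ℓN ∈ S, ℓN.1 ≠ p ∧ ∀ k < ℓN.2 + 1, p ^ k ∣ ℓN.2 → p ^ k ∣ t)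

/-- **The torsion annihilator.** If every `(ℓ, N) ∈ S` has `ℓ` prime and kills prime-to-`ℓ` orders
on `A`, and `annihilatorCheck S t = true`, then `t • x = 0` for every `x ∈ A` of finite order: by
`Nat.dvd_iff_prime_pow_dvd_dvd` it suffices that every prime power `p^k ∣ ord(x)` divides `t`; for
`p < annBound S` the certificate names an `ℓ ≠ p` with `p^k ∣ N_ℓ` (previous lemma) `∣`-transferred to
`t`; a prime `p ≥ annBound S` cannot divide `ord(x)` at all (`p ≤ N_ℓ < annBound S` for the head
entry). [cite: CremonaAlgorithms1997, §3.5] -/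
theorem nsmul_eq_zero_of_annihilatorCheck {S : List (ℕ × ℕ)} {t : ℕ}
    (hS : ∀ ℓN ∈ S, ℓN.1.Prime ∧ ∀ (x : A) (n : ℕ), ¬ ℓN.1 ∣ n → n • x = 0 → ℓN.2 • x = 0)
    (ht : annihilatorCheck S t = true) {x : A} (hx : IsOfFinAddOrder x) : t • x = 0 := by
  simp only [annihilatorCheck, decide_eq_true_eq] at ht
  obtain ⟨hne, hpos, hcheck⟩ := ht
  rw [← addOrderOf_dvd_iff_nsmul_eq_zero, Nat.dvd_iff_prime_pow_dvd_dvd]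
  intro p k hp hk
  rcases Nat.eq_zero_or_pos k with rfl | hk0
  · simp
  have key : ∀ ℓN ∈ S, ℓN.1 ≠ p → p ^ k ∣ ℓN.2 ∧ k < ℓN.2 + 1 ∧ p ≤ ℓN.2 := by
    intro ℓN hmem hne'
    have hdvd := pow_dvd_of_kills_primeTo (hS ℓN hmem).1 (hS ℓN hmem).2 hx hp (Ne.symm hne') hk
    have hle : p ^ k ≤ ℓN.2 := Nat.le_of_dvd (hpos ℓN hmem) hdvd
    refine ⟨hdvd, ?_, ?_⟩
    · have := Nat.lt_pow_self (n := k) hp.one_lt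
      omega
    · exact le_trans (Nat.le_self_pow hk0.ne' p) hle
  by_cases hpB : p < annBound S
  · rcases hcheck p hpB with h2 | ⟨m, hm, h2m, hpm⟩ | ⟨ℓN, hmem, hne', hℓN⟩
    · exact absurd hp.two_le (not_le.mpr h2)
    · exact absurd (Nat.dvd_of_mod_eq_zero hpm) ((Nat.prime_def_lt'.mp hp).2 m h2m hm)
    · obtain ⟨hdvd, hkN, -⟩ := key ℓN hmem hne'
      exact hℓN k hkN hdvd
  · exfalso
    obtain ⟨ℓN, hmem⟩ := List.exists_mem_of_ne_nil S hne
    have hb := lt_annBound hmem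
    have hne' : ℓN.1 ≠ p := by omega
    have := (key ℓN hmem hne').2.2
    omega

/-- `ℤ`-scalar form consumed by `linearIndependent_pair_of_cosetWitness` (`t = 2^u · m`). [folklore] -/
theorem zsmul_eq_zero_of_annihilatorCheck {S : List (ℕ × ℕ)} {t : ℕ}
    (hS : ∀ ℓN ∈ S, ℓN.1.Prime ∧ ∀ (x : A) (n : ℕ), ¬ ℓN.1 ∣ n → n • x = 0 → ℓN.2 • x = 0)
    (ht : annihilatorCheck S t = true) {u : ℕ} {m : ℤ} (htm : (t : ℤ) = 2 ^ u * m) (x : A)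
    (hx : IsOfFinAddOrder x) : ((2 : ℤ) ^ u * m) • x = 0 := by
  rw [← htm, natCast_zsmul]
  exact nsmul_eq_zero_of_annihilatorCheck hS ht hx

end Annihilator

/-! ### The kernel point count over `ZMod q` is Mathlib's `Nat.card` of the point type -/

section Count

/-- The computable point count `#Ẽ(ZMod q)` of the integral model `V` read modulo `q`: the affine
solutions of the Weierstrass equation in `(ZMod q)²` plus the point at infinity (Cremona 1997 §2.4;
evaluated by `decide`). [cite: CremonaAlgorithms1997, §2.4] -/
def zmodPointCount (V : WeierstrassCurve ℤ) (q : ℕ) [NeZero q] : ℕ :=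
  (Finset.univ.filter fun xy : ZMod q × ZMod q =>
    xy.2 ^ 2 + (V.a₁ : ZMod q) * xy.1 * xy.2 + (V.a₃ : ZMod q) * xy.2 =
      xy.1 ^ 3 + (V.a₂ : ZMod q) * xy.1 ^ 2 + (V.a₄ : ZMod q) * xy.1 + (V.a₆ : ZMod q)).card + 1

variable (V : WeierstrassCurve ℤ) (q : ℕ) [Fact q.Prime]

/-- **`Nat.card Ẽ(𝔽_q) = zmodPointCount V q`** for a prime `q ∤ Δ(V)`: Mathlib's
`Affine.nonsingularPointEquiv` (points = `Option` of nonsingular affine pairs) and "on the curve ⇔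
nonsingular" for `Δ ≠ 0`. This is the identification of the engines' / kernel's naive count with the
order of the Mathlib point group. [cite: CremonaAlgorithms1997, §2.4] -/
theorem natCard_point_eq_zmodPointCount (hq : ¬ (q : ℤ) ∣ V.Δ) :
    Nat.card (V.map (Int.castRingHom (ZMod q))).toAffine.Point = zmodPointCount V q := by
  have hiff : ∀ xy : ZMod q × ZMod q,
      (V.map (Int.castRingHom (ZMod q))).toAffine.Nonsingular xy.1 xy.2 ↔
      xy.2 ^ 2 + (V.a₁ : ZMod q) * xy.1 * xy.2 + (V.a₃ : ZMod q) * xy.2 =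
        xy.1 ^ 3 + (V.a₂ : ZMod q) * xy.1 ^ 2 + (V.a₄ : ZMod q) * xy.1 + (V.a₆ : ZMod q) := by
    intro xy
    rw [← Affine.equation_iff_nonsingular_of_Δ_ne_zero (Δ_zmod_ne_zero V q hq),
      Affine.equation_iff]
    simp [WeierstrassCurve.map]
  have e := (Affine.nonsingularPointEquiv (V.map (Int.castRingHom (ZMod q))).toAffine).trans
    (Equiv.subtypeEquivRight hiff).optionCongr
  rw [Nat.card_congr e, Nat.card_eq_fintype_card, Fintype.card_option, Fintype.card_subtype,
    zmodPointCount]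

/-- **A kernel-checked count gives the prime-to-`q` killer `(q, N)` on `E(ℚ)`**: if
`zmodPointCount V q = N` (`q ∤ Δ`) then `n • x = 0`, `q ∤ n` ⟹ `N • x = 0`.
[cite: SilvermanAEC2009, Prop. VII.3.1(b)] -/
theorem kills_primeTo_of_zmodPointCount (hq : ¬ (q : ℤ) ∣ V.Δ) {N : ℕ}
    (hN : zmodPointCount V q = N) :
    ∀ (x : (V.map (Int.castRingHom ℚ)).toAffine.Point) (n : ℕ), ¬ q ∣ n → n • x = 0 →
      N • x = 0 := by
  classical
  intro x n hn h
  rw [← hN, ← natCard_point_eq_zmodPointCount V q hq]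
  exact card_nsmul_eq_zero_of_nsmul_eq_zero V q hq x hn h

/-- The empty list of killers (base case for assembling the hypothesis `hS` of the annihilator
from per-prime kernel counts). [folklore] -/
theorem killers_nil :
    ∀ ℓN ∈ ([] : List (ℕ × ℕ)), ℓN.1.Prime ∧
      ∀ (x : (V.map (Int.castRingHom ℚ)).toAffine.Point) (n : ℕ), ¬ ℓN.1 ∣ n → n • x = 0 →
        ℓN.2 • x = 0 := by
  simp

omit [Fact q.Prime] in
/-- Consing one kernel-counted good prime `(q, N)` onto a list of killers. [folklore] -/
theorem killers_cons {q N : ℕ} [Fact q.Prime] (hq : ¬ (q : ℤ) ∣ V.Δ)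
    (hN : zmodPointCount V q = N) {S : List (ℕ × ℕ)}
    (hS : ∀ ℓN ∈ S, ℓN.1.Prime ∧
      ∀ (x : (V.map (Int.castRingHom ℚ)).toAffine.Point) (n : ℕ), ¬ ℓN.1 ∣ n → n • x = 0 →
        ℓN.2 • x = 0) :
    ∀ ℓN ∈ (q, N) :: S, ℓN.1.Prime ∧
      ∀ (x : (V.map (Int.castRingHom ℚ)).toAffine.Point) (n : ℕ), ¬ ℓN.1 ∣ n → n • x = 0 →
        ℓN.2 • x = 0 := by
  intro ℓN h
  rcases List.mem_cons.mp h with rfl | h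
  · exact ⟨Fact.out, kills_primeTo_of_zmodPointCount V q hq hN⟩
  · exact hS ℓN h

end Count

end Summit.BirchSwinnertonDyer.BirchSwinnertonDyer.Rank2Observatory
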